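import Summits.BirchSwinnertonDyer.BirchSwinnertonDyer.Theorems.UniversalToricDescentTameLayerCount
import Summits.BirchSwinnertonDyer.BirchSwinnertonDyer.Theorems.UniversalToricDescentLayerDescentFiniteKernel
import Summits.BirchSwinnertonDyer.BirchSwinnertonDyer.Theorems.UniversalToricDescentLocalH1DivisibleCurve
import Summits.BirchSwinnertonDyer.BirchSwinnertonDyer.Theorems.UniversalToricDescentSigmaLocalFinite
import Summits.BirchSwinnertonDyer.Rank1Residual.X11b.AnticyclotomicLocalTowerTorsion
import HarnessLib

/-!
# The local torsion count at a TAME place finitely decomposed in a `ℤ_p`-tower, MODULO the finiteness of the layer invariants: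
# `(∀ m, E[p^∞]^{G_m} finite) ⟹ #H¹(kerD κ v, E[p^∞])[p^k] ≤ #E[p^∞]^{kerD κ v}[p^k]`
# (crux ♭T≤ stmt-BirchSwinnertonDyer-23042, line `sigmacongruence`, stub R3 `stub_localTorsionCountAtTame` = this ∧ FIN)

Width prover `bsd-wall-utd-p1-w2` g1 under lead `bsd-wall-utd-p1` g18 (`--supports stmt-BirchSwinnertonDyer-23042`, helper). THEOREMS
ONLY (no definition, no named fact, no `sorry`). BSD is not proved by any of this.

Assembly of the lead's v9 route for R3 in the tree's `D_v`-currency, for `W/K` elliptic, any `ℤ_p`-extension `κ`, `v ∤ p` with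
`D_v ⊄ ker κ`, GIVEN the finiteness FIN of `E[p^∞]^{G_m}` for every layer `G_m = {d ∈ D_v : p^m ∣ κ d}` (`= E(L_m)[p^∞]` for the finite
layers `L_m/K_v` of `K_{∞,w}`; NOT in the tree at `m > 0` — R3 = this theorem ∧ FIN):
1. EXHAUSTION: `H¹(kerD, A)[p^k]` is finite (`…LocalH1Divisible.natCard_pow_torsion_subgroupH1_kerD_eq_pow_mul`) and its classes have a
   common stabiliser depth `t` (`…SigmaLocalStabilizer.exists_forall_dvd_imp_conjH1_kerD_eq_finset`), so at the layer `n = t` every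
   class of `H¹(kerD, A)[p^k]` lies in `S(n,k) = {y | p^k y = 0, conj_{d₁^{p^n}} y = y}`;
2. DESCENT with finite layer invariants (brick (D), `…LayerDescentFiniteKernel`): `#S(n,k) ≤ #H¹(G_n, A)[p^k]`;
3. TAME LAYER COUNT (brick (T), `…TameLayerCount`): `#H¹(G_n, A)[p^k] ≤ #A^{G_n}[p^k]`;
4. `A^{G_n} ⊆ A^{kerD}` (`kerD ≤ G_n`).
References: [GreenbergVatsal2000] §2 Prop. (2.4) and proof (p. 22); [GreenbergLNM1716] §3 Lemma 3.1–3.3; [MilneADT2006] I Thm. 2.8, Cor. 2.3.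
-/

set_option autoImplicit false
-- the Theorems namespace of this sub repeats the summit name by design (D-0017 nested layout)
set_option linter.dupNamespace false

noncomputable section

open scoped Classical
open Function Field NumberField IsDedekindDomain WeierstrassCurve
open Literature.NumberTheory.GaloisRepresentations Literature.NumberTheory.EllipticCurves
  Literature.NumberTheory.EllipticCurves.GreenbergSelmer
  Summit.BirchSwinnertonDyer.Rank1Residual Summit.BirchSwinnertonDyer.Rank1Residual.X11b
  Summit.BirchSwinnertonDyer.Rank1Residual.X11b.Coinv Summit.BirchSwinnertonDyer.Rank1Residual.X11b.ProcyclicDescent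
  Summit.BirchSwinnertonDyer.BirchSwinnertonDyer.Theorems
  Summit.BirchSwinnertonDyer.BirchSwinnertonDyer.Theorems.UniversalToricDescentStrictPlaceLocalCount
  Summit.BirchSwinnertonDyer.BirchSwinnertonDyer.Theorems.UniversalToricDescentTowerDescent

universe u

namespace Summit.BirchSwinnertonDyer.BirchSwinnertonDyer.Theorems.UniversalToricDescentTameLocalTorsionCount

variable {K : Type} [Field K] [NumberField K] (W : WeierstrassCurve K) [W.IsElliptic] (p : ℕ) [Fact p.Prime]
  (κ : ZpExtension K p) (v : HeightOneSpectrum (𝓞 K))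

/-- **R3 modulo FIN: `#H¹(kerD κ v, E[p^∞])[p^k] ≤ #E[p^∞]^{kerD κ v}[p^k]` at a place `v ∤ p` finitely decomposed in `κ`, granted
the finiteness of `E[p^∞]^{G_m}` for every layer `G_m = {d ∈ D_v : p^m ∣ κ d}`.** See the module docstring for the chain
(exhaustion, finite-kernel descent (D), tame layer count (T), `kerD ≤ G_n`). [cite: GreenbergVatsal2000, §2 Prop. (2.4) and proof (p. 22)]
[cite: GreenbergLNM1716, §3 Lemma 3.3] [cite: MilneADT2006, I Thm. 2.8, Cor. 2.3] -/
theorem natCard_pow_torsion_subgroupH1_kerD_le_of_finite_layerFixed (hpv : ((p : ℕ) : 𝓞 K) ∉ v.asIdeal)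
    (hvd : ¬ (decomp v ≤ κ.kerSubgroup))
    (hFIN : ∀ m : ℕ, Finite {a : W.geomPrimaryTorsion p //
      ∀ d : decomp (K := K) v, (p : ℤ_[p]) ^ m ∣ (κ (d : absoluteGaloisGroup K)).toAdd → (d : absoluteGaloisGroup K) • a = a})
    (k : ℕ) :
    Nat.card {f : subgroupH1 (kerD κ v) (W.geomPrimaryTorsion p) // p ^ k • f = 0} ≤
      Nat.card {a : W.geomPrimaryTorsion p //
        (∀ g : kerD κ v, ((g : decomp (K := K) v) : absoluteGaloisGroup K) • a = a) ∧ p ^ k • a = 0} := by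
  have hp : p.Prime := Fact.out
  haveI : CompactSpace (absoluteGaloisGroup K) := absoluteGaloisGroup_compactSpace K
  haveI : CompactSpace (decomp (K := K) v) := isCompact_iff_compactSpace.mp (isClosed_decomp v).isCompact
  -- notation
  let A : Type := W.geomPrimaryTorsion p
  let G : Type := decomp (K := K) v
  let κ₀ : G →ₜ* Multiplicative ℤ_[p] := kappaD κ v
  have hκ₀ : ∀ g : G, κ₀ g = κ (g : absoluteGaloisGroup K) := fun _ ↦ rfl
  have hstab := Summit.BirchSwinnertonDyer.Rank1Residual.X11b.LocBridge.isOpen_stabilizer_geomPrimaryTorsion W p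
  have hA : ∀ a : A, IsOpen {g : G | g • a = a} := fun a ↦ (hstab a).preimage continuous_subtype_val
  have hAt : IsPrimaryTorsion p A := isPrimaryTorsion_geomPrimaryTorsion W p
  have hAp : Set.Finite {a : A | p • a = 0} := by
    simpa only [pow_one] using AcSelmer.finite_setOf_geomPrimaryTorsion_pow_smul_eq_zero W hp.ne_zero 1
  have hApk : Set.Finite {a : A | p ^ k • a = 0} := AcSelmer.finite_setOf_geomPrimaryTorsion_pow_smul_eq_zero W hp.ne_zero k
  -- exact index of `D_v`
  obtain ⟨c, ⟨d₁, hd₁⟩, hc, -⟩ := UniversalToricDescentSigmaLocalStabilizer.exists_pow_and_forall_dvd_of_not_le κ v hvd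
  have hd₁' : (κ₀ d₁).toAdd = (p : ℤ_[p]) ^ c := hd₁
  -- (1) exhaustion: `H¹(kerD, A)[p^k]` is finite with a common stabiliser depth `t`
  obtain ⟨sv, hsv⟩ := UniversalToricDescentSigmaLocalImage.exists_natCard_pTorsion_subgroupH1_kerD_eq_pow W κ hpv hvd
  have hTk := UniversalToricDescentLocalH1Divisible.natCard_pow_torsion_subgroupH1_kerD_eq_pow_mul W κ hpv hvd hsv k
  haveI hTfin : Finite {f : subgroupH1 (kerD κ v) A // p ^ k • f = 0} :=
    Nat.finite_of_card_ne_zero (by rw [hTk]; exact pow_ne_zero _ hp.ne_zero)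
  have hTset : Set.Finite {f : subgroupH1 (kerD κ v) A | p ^ k • f = 0} := Set.finite_coe_iff.mp hTfin
  obtain ⟨t, k', ht⟩ := UniversalToricDescentSigmaLocalStabilizer.exists_forall_dvd_imp_conjH1_kerD_eq_finset κ hstab hAt v hc
    hTset.toFinset
  have hfix : ∀ y : subgroupH1 (kerK κ₀) A, ∃ t : ℕ, ∀ g : G, (p : ℤ_[p]) ^ t ∣ (κ₀ g).toAdd → conjH1 (kerK κ₀) A g y = y :=
    fun y ↦ UniversalToricDescentSigmaLocalStabilizer.exists_forall_dvd_imp_conjH1_kerD_eq κ hstab v hc y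
  -- the layer `n = t`
  obtain ⟨Gn, hGn⟩ := exists_layer κ₀ (c + t)
  have hGn' : ∀ g : G, g ∈ Gn ↔ (p : ℤ_[p]) ^ (c + t) ∣ (κ (g : absoluteGaloisGroup K)).toAdd := hGn
  have hGc : IsClosed (Gn : Set G) := isClosed_layer κ₀ hGn
  have hH : kerK κ₀ ≤ Gn := kerK_le_layer κ₀ hGn
  -- the layer invariants are finite (FIN at depth `c + t`), in the two currencies used by the bricks
  haveI hFixfin : Finite {a : A // ∀ g : G, g ∈ Gn → g • a = a} := by
    haveI := hFIN (c + t)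
    refine Finite.of_injective (fun a ↦ (⟨a.1, fun d hd ↦ a.2 d ((hGn d).mpr hd)⟩ : {a : A //
      ∀ d : G, (p : ℤ_[p]) ^ (c + t) ∣ (κ (d : absoluteGaloisGroup K)).toAdd → (d : absoluteGaloisGroup K) • a = a})) ?_
    intro a b h
    exact Subtype.ext (congrArg Subtype.val h :)
  haveI hFixfin' : Finite (FixedPoints.addSubgroup Gn A) := by
    refine Finite.of_injective (fun a : FixedPoints.addSubgroup Gn A ↦
      (⟨a.1, fun g hg ↦ a.2 ⟨g, hg⟩⟩ : {a : A // ∀ g : G, g ∈ Gn → g • a = a})) ?_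
    intro a b h
    exact Subtype.ext (congrArg Subtype.val h :)
  -- (3) the tame layer count
  obtain ⟨hHfin, hT⟩ := UniversalToricDescentTameLayerCount.finite_and_natCard_pow_torsion_subgroupH1_layer_le W p κ v hpv hGn' k
  haveI := hHfin
  -- (2) the finite-kernel descent
  obtain ⟨-, hD⟩ := UniversalToricDescentLayerDescentFiniteKernel.finite_and_natCard_pTorsion_pow_conj_fixed_le κ₀ hd₁' hGn hA hAt hGc
    hAp hfix k
  -- (1') every `p^k`-torsion class is fixed by `conj_{d₁^{p^t}}`
  have hmem : ∀ f : subgroupH1 (kerD κ v) A, p ^ k • f = 0 → conjH1 (kerK κ₀) A (d₁ ^ p ^ t) f = f := by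
    intro f hf
    have hfT : f ∈ hTset.toFinset := by rw [Set.Finite.mem_toFinset]; exact hf
    refine (ht f hfT).2 (d₁ ^ p ^ t) ?_
    rw [← hκ₀, toAdd_apply_pow (n := t) κ₀ hd₁']
    exact pow_dvd_pow _ (Nat.le_add_left t c)
  have h1 : Nat.card {f : subgroupH1 (kerD κ v) A // p ^ k • f = 0} ≤
      Nat.card {y : subgroupH1 (kerK κ₀) A // p ^ k • y = 0 ∧ conjH1 (kerK κ₀) A (d₁ ^ p ^ t) y = y} := by
    haveI : Finite {y : subgroupH1 (kerK κ₀) A // p ^ k • y = 0 ∧ conjH1 (kerK κ₀) A (d₁ ^ p ^ t) y = y} :=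
      Finite.of_injective (fun y ↦ (⟨y.1, y.2.1⟩ : {f : subgroupH1 (kerD κ v) A // p ^ k • f = 0}))
        fun a b h ↦ Subtype.ext (congrArg Subtype.val h :)
    exact Nat.card_le_card_of_injective (fun f ↦ ⟨f.1, f.2, hmem f.1 f.2⟩) fun a b h ↦ Subtype.ext (congrArg Subtype.val h :)
  -- (4) `A^{G_n}[p^k] ⊆ A^{kerD}[p^k]`
  have h4 : Nat.card {a : FixedPoints.addSubgroup Gn A // p ^ k • a = 0} ≤
      Nat.card {a : A // (∀ g : kerD κ v, ((g : G) : absoluteGaloisGroup K) • a = a) ∧ p ^ k • a = 0} := by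
    haveI : Finite {a : A // (∀ g : kerD κ v, ((g : G) : absoluteGaloisGroup K) • a = a) ∧ p ^ k • a = 0} := by
      haveI : Finite {a : A // p ^ k • a = 0} := hApk.to_subtype
      exact Finite.of_injective (fun a ↦ (⟨a.1, a.2.2⟩ : {a : A // p ^ k • a = 0}))
        fun a b h ↦ Subtype.ext (congrArg Subtype.val h :)
    refine Nat.card_le_card_of_injective (fun a ↦ ⟨(a.1 : A), fun g ↦ a.1.2 ⟨(g : G), hH g.2⟩, ?_⟩) ?_
    · have e := congrArg (fun x : FixedPoints.addSubgroup Gn A ↦ (x : A)) a.2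
      simpa only [AddSubgroupClass.coe_nsmul, ZeroMemClass.coe_zero] using e
    · intro a b h
      exact Subtype.ext (Subtype.ext (congrArg Subtype.val h :))
  exact h1.trans (hD.trans (hT.trans h4))

end Summit.BirchSwinnertonDyer.BirchSwinnertonDyer.Theorems.UniversalToricDescentTameLocalTorsionCount

end
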